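import Summits.QuantumAdvantage.QuantumAdvantage.Theorems.WbwObfuscatedGluedTreesKowLevelVocabulary
import Literature.Computability.Cryptography.ObfuscatedGluedTrees

/-!
# `WbwObfuscatedGluedTrees` (stmt-QuantumAdvantage-2340) — line `knowledge-of-walk-split`, instantiation pass: LEVEL DATA of the landed generator

Definitions file (lead seat prover-line-stmt-QuantumAdvantage-2340-c1-0).  For an ARBITRARY parameter record
`Λ : Params` of the landed generator `Literature.Computability.Cryptography.ObfuscatedGluedTrees.gen Λ O P`
(no master-data restriction: the level `n` is passed explicitly to the level-aware shapes
`genObfL / genClearL / keyedL` of `WbwObfuscatedGluedTreesKowLevelVocabulary`), the data of the line: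

* `refKeyLen Λ ρ n = min n (4 · keyPartLen n + ρ n)` — the key of the line is the generator's key material
  `K = s.take (4 · keyPartLen n)` followed by `ρ n` further seed bits (the coins of a REFERENCE obfuscation,
  hypothesis-level; `ρ = 0` is allowed);
* `shipFamily Λ n k = Λ.circ n (k.take (4 · keyPartLen n))` — the SHIPPED presentation (ignores the reference coins);
* `entranceOf Λ P n k`, `exitOf Λ P n k` — `name_K(ENTRANCE)`, `name_K(EXIT)` read off the key;
* `refGen Λ P ρ C₁ = genClearL …` — the CLEAR reference generator of a reference presentation family
  `C₁ : (n : ℕ) → List Bool → Circuit (Fin (N n + N n))` (intended: a padded obfuscation of `Λ.circ n K` by one fixed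
  honest obfuscator with coins the `ρ n` extra key bits; never the universally quantified `O` — Disproof §7 (T-d′));
* `refAnswer Λ P ρ = keyedL … (exitOf Λ P)`;
* `seedSwap Λ ρ = blockSwap (4 · keyPartLen) Λ.coinLen ρ` — the seed re-parametrisation moving the generator's coin
  segment behind the reference coins;
* `LevelAdmissible Λ O ρ C₁` — the definitional side conditions (schedules, sizes, lengths, coin budget) under which the
  level-aware transfer lemmas apply and `gen Λ O P` is `genObfL … (shipFamily Λ) … ∘ seedSwap Λ ρ` eventually.

No hardness content anywhere in this file.
-/

set_option linter.dupNamespace false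

noncomputable section

namespace Summit.QuantumAdvantage.QuantumAdvantage.Theorems.WbwObfuscatedGluedTrees.KnowledgeOfWalk.LevelGen

open Literature.Computability.Cryptography Literature.Computability.Complexity Filter Asymptotics
open Literature.Computability.Cryptography.ObfuscatedGluedTrees
open Summit.QuantumAdvantage.QuantumAdvantage.Theorems.WbwObfuscatedGluedTrees.KnowledgeOfWalk
  (genObfL genClearL keyedL blockSwap)

variable (Λ : Params) (O : CircuitObfuscator) (P : PuncturablePRFScheme) (ρ : ℕ → ℕ)

/-- Length of the generator's key material at seed length `n`: `4 · keyPartLen n`. [folklore] -/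
abbrev keyLen (n : ℕ) : ℕ := 4 * Λ.keyPartLen n

/-- Key length of the line at seed length `n`: key material plus `ρ n` reference-coin bits, capped at `n`. [folklore] -/
def refKeyLen (n : ℕ) : ℕ := min n (keyLen Λ n + ρ n)

/-- `refKeyLen Λ ρ n ≤ n`. [folklore] -/
theorem refKeyLen_le (n : ℕ) : refKeyLen Λ ρ n ≤ n := min_le_left _ _

/-- The SHIPPED presentation family, level-aware, reading the key material off the line's key. [folklore] -/
def shipFamily (n : ℕ) (k : List Bool) : Circuit (Fin (Λ.N n + Λ.N n)) := Λ.circ n (k.take (keyLen Λ n))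

/-- `name_K(ENTRANCE)` read off the line's key. [folklore] -/
def entranceOf (n : ℕ) (k : List Bool) : List Bool := Λ.entranceName P n (k.take (keyLen Λ n))

/-- `name_K(EXIT)` read off the line's key. [folklore] -/
def exitOf (n : ℕ) (k : List Bool) : List Bool := Λ.exitName P n (k.take (keyLen Λ n))

/-- The arity schedule `2 N(n)` as a level-aware family (constant in the key). [folklore] -/
abbrev arity (n : ℕ) (_k : List Bool) : ℕ := Λ.N n + Λ.N n

/-- The CLEAR reference generator of a reference presentation family `C₁`. [folklore] -/
def refGen (C₁ : (n : ℕ) → List Bool → Circuit (Fin (Λ.N n + Λ.N n))) : List Bool → List Bool :=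
  genClearL (refKeyLen Λ ρ) (arity Λ) C₁ (entranceOf Λ P)

/-- The keyed reference answer `name_K(EXIT)`. [folklore] -/
def refAnswer : List Bool → List Bool := keyedL (refKeyLen Λ ρ) (exitOf Λ P)

/-- The obfuscated level-aware generator of the shipped family (what the transfer lemmas produce). [folklore] -/
def shipGen : List Bool → List Bool :=
  genObfL O Λ.secParam (refKeyLen Λ ρ) (arity Λ) (shipFamily Λ) (entranceOf Λ P)

/-- The seed re-parametrisation: swap the generator's coin segment (length `coinLen n`, right after the key
material) with the following `ρ n` bits. [folklore] -/
def seedSwap : List Bool → List Bool := blockSwap (keyLen Λ) Λ.coinLen ρ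

/-- **Definitional admissibility of `(Λ, ρ, C₁)` for the obfuscator `O`** (no hardness content):
(1) `secParam` unary-poly-time; (2) `n^c ≤ secParam n` eventually; (3) `secParam n ≤ poly(n)`;
(4) polynomial length of the two clear instances, names and answers at every level/key;
(5) shipped and reference presentations lie in `ppolyCircuits (secParam n)`, have equal size and equal function;
(6) eventually the obfuscator's coin demand on both fits in the seed after the key;
(7) eventually the seed holds key material + reference coins + generator coins, and the generator's coin schedule IS
the obfuscator's coin demand on the shipped circuit. [folklore] -/
def LevelAdmissible (C₁ : (n : ℕ) → List Bool → Circuit (Fin (Λ.N n + Λ.N n))) : Prop :=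
  PolyTimeComputable Computability.unaryEncodeNat Computability.unaryEncodeNat Λ.secParam ∧
  (∃ c : ℝ, 0 < c ∧ ∀ᶠ n : ℕ in atTop, (n : ℝ) ^ c ≤ Λ.secParam n) ∧
  (∃ p : Polynomial ℕ, ∀ n, Λ.secParam n ≤ p.eval n) ∧
  (∃ q : Polynomial ℕ, ∀ (n : ℕ) (k : List Bool), k.length = refKeyLen Λ ρ n →
      (encodeSizedCircuit ⟨Λ.N n + Λ.N n, shipFamily Λ n k⟩).length +
        (encodeSizedCircuit ⟨Λ.N n + Λ.N n, C₁ n k⟩).length +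
        (entranceOf Λ P n k).length + (exitOf Λ P n k).length ≤ q.eval n) ∧
  (∀ (n : ℕ) (k : List Bool), k.length = refKeyLen Λ ρ n →
      (⟨Λ.N n + Λ.N n, shipFamily Λ n k⟩ : SizedCircuit) ∈ ppolyCircuits (Λ.secParam n) ∧
      (⟨Λ.N n + Λ.N n, C₁ n k⟩ : SizedCircuit) ∈ ppolyCircuits (Λ.secParam n) ∧
      (shipFamily Λ n k).size = (C₁ n k).size ∧ (∀ x, (shipFamily Λ n k).eval x = (C₁ n k).eval x)) ∧
  (∃ n₀ : ℕ, ∀ n, n₀ ≤ n → ∀ k : List Bool, k.length = refKeyLen Λ ρ n →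
      O.coins (Λ.secParam n) (shipFamily Λ n k) ≤ n - refKeyLen Λ ρ n ∧
      O.coins (Λ.secParam n) (C₁ n k) ≤ n - refKeyLen Λ ρ n) ∧
  (∃ n₀ : ℕ, ∀ n, n₀ ≤ n → keyLen Λ n + ρ n + Λ.coinLen n ≤ n ∧
      ∀ K : List Bool, K.length = keyLen Λ n → Λ.coinLen n = O.coins (Λ.secParam n) (Λ.circ n K))

/-- Registered helper stub of crux stmt-QuantumAdvantage-2340 (so this definitions file can ride `--supports`):
the reference generator unfolds to the level-aware clear shape. [folklore] -/
theorem toolkit_genLevelData :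
    ∀ (Λ : Params) (P : PuncturablePRFScheme) (ρ : ℕ → ℕ)
      (C₁ : (n : ℕ) → List Bool → Circuit (Fin (Λ.N n + Λ.N n))),
      refGen Λ P ρ C₁ = genClearL (refKeyLen Λ ρ) (arity Λ) C₁ (entranceOf Λ P) :=
  fun _ _ _ _ => rfl

end Summit.QuantumAdvantage.QuantumAdvantage.Theorems.WbwObfuscatedGluedTrees.KnowledgeOfWalk.LevelGen

end
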